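import Summits.HubbardSuperconductivity.HubbardSuperconductivity.Theses.DeformationLadder
import Summits.HubbardSuperconductivity.HubbardSuperconductivity.Theorems.NoGoNogoThesis

/-!
# Route `DeformationLadder` — glue item `RigidityGlue` (stmt-HubbardSuperconductivity-14525)

`LowEnergyRigidity → StiffnessImpliesPenalised → PenalisedGroundStateExists → LadderThesis`:
pure logic.  Take `(U, δ, κ, a, L₀)` from `LowEnergyRigidity` and put `s := κ/64`
(so `s ∈ Ioc 0 (κ/64)`).  At an even side `L ≥ L₀`, `PenalisedGroundStateExists` with
`c := (κ/64)/L⁴` and `n := ⌊(1-δ)L²/2⌋ ≤ L²` (`NoGo.floor_pairNumber_le`, which only needs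
`δ ≥ -1`) gives a unit `(N_L, S^z = 0)`-sector ground state `φ` of the penalised model
`H + (s/L⁴)·pFᴴpF`, and `StiffnessImpliesPenalised` at `(L, U, κ, a, N_L)`, fed with the
rigidity hypothesis at `L`, gives `a ≤ L⁻⁴ Re⟨φ, pFᴴpF φ⟩` — exactly the `∃ φ` clause of
`LadderThesis` (all casts match syntactically).

Sources: Kaplan–Horsch–von der Linden (1989); Scalapino, Phys. Rep. 250 (1995) §2.
-/

set_option linter.dupNamespace false -- summit = problem name (single-conjunct summit), D-0017

namespace Summit.HubbardSuperconductivity.HubbardSuperconductivity.Theorems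

open Summit.HubbardSuperconductivity.HubbardSuperconductivity.Theses.DeformationLadder

/-- **`RigidityGlue`** (stmt-HubbardSuperconductivity-14525): low-energy phase rigidity of the
pure model (`LowEnergyRigidity`), the finite-`L` transfer to ground states of the
`(s/L⁴)`-penalised model (`StiffnessImpliesPenalised`, used at `s := κ/64`) and the existence of
normalised penalised sector ground states (`PenalisedGroundStateExists`, used at
`c := (κ/64)/L⁴`, `n := ⌊(1-δ)L²/2⌋ ≤ L²`) give the route thesis `LadderThesis`. Pure logic.
Kaplan–Horsch–von der Linden (1989); Scalapino (1995) §2. -/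
theorem rigidityGlue_proof :
    Summit.HubbardSuperconductivity.HubbardSuperconductivity.Theses.DeformationLadder.RigidityGlue := by
  unfold RigidityGlue
  rintro ⟨U, hU, δ, hδ, κ, hκ, a, ha, L₀, hrig⟩ hstiff hgs
  refine ⟨U, hU, δ, hδ, κ / 64, by positivity, a, ha, L₀, ?_⟩
  intro L _ hL hEven
  obtain ⟨φ, hφ₁, hφgs⟩ := hgs L U (κ / 64 / (L : ℝ) ^ 4) ⌊(1 - δ) * (L : ℝ) ^ 2 / 2⌋₊
    (Summit.HubbardSuperconductivity.NoGo.floor_pairNumber_le δ (by linarith [hδ.1]) L)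
  exact ⟨φ, hφ₁, hφgs, hstiff L U κ a _ hκ (hrig L hL hEven) (κ / 64) ⟨by positivity, le_rfl⟩
    φ hφ₁ hφgs⟩

end Summit.HubbardSuperconductivity.HubbardSuperconductivity.Theorems
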